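import Summits.NavierStokesRegularity.NavierStokesRegularity.Theorems.SoloRefuteSiche2026Step6Field
import HarnessLib

/-!
# C135 `Siche2026` — solo refutation of Step 6 (Proposition 7.2 (59) p. 24), face (B): the kill

Part 2 of 2 (imports the field block `SoloRefuteSiche2026Step6Field`).
`Literature.Claims.NS.Siche2026.Step6_vorticityBound` types Proposition 7.2 (59) of the text of record
(v1.5, Zenodo 10.5281/zenodo.19899171, p. 24) AT FIELD GRAIN with exactly the printed hypothesis: for each
`ν > 0` a function `C(E₀, C_χ)` such that every smooth divergence-free field `v` on `𝕋³` with kinetic energy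
`≤ E₀` and all shifted shell coherences `χ_K(x) ≤ C_χ` satisfies `|ω(x)|² ≤ C² · ‖∇v‖²_{L²}` at every point.

**It is false** (`not_Step6_vorticityBound`). Witness: the aligned lacunary shear sums `u_M = shearW M 1 1`
of part 1. (i) Every shell coherence of `u_M` is `≤ 12` (`coherence_shearW_le`): the occupied shells are
`|k|² = 4^a`, and the lattice sphere `x² + y² + z² = 4^a` is exactly `{±2^a eᵢ}` (mod-4 descent,
`sum_sq_eq_four_pow_iff`), so `N_{4^a} = 2 · 6 = 12` and `χ_K ≤ N_K` (`coherence_le_shellModes`, in the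
skeleton); on every other shell all Fourier (hence helical) coefficients of `u_M` vanish
(`mFourierCoeff_realTrigPoly_eq_zero`), so `m_K = 0` and `χ_K = 0`. In gauge (39) the modes `±2^a e₁` have
`ê₁ = ∓x̂`, so the `e₀`-polarised coefficients ARE seen by the typed `χ` — the bound used is `χ ≤ N_K`, not
polarisation blindness. (ii) `E(u_M) ≤ 1/12 ≤ 1`, `‖∇u_M‖² = 2π²M`, `|ω(0)|² = (∂₁(u_M)₀(0))² = (2πM)²`
(`torusVorticitySqAt_shearW_origin`). So at fixed `(E₀, C_χ) = (1, 12)` the ratio `|ω(0)|²/‖∇u_M‖² = 2M`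
is unbounded, contradicting any `C(1, 12)`. The printed proof's «K_max ∼ Re^{3/4} fixed by initial data»
(p. 24 l.−6…−1) is the locus: the shell sum is truncated at a data-dependent `K_max` that is not a hypothesis
of (59).

Kit: ns-claims-typist-10 g3 (face (B) of the C135 kit pool, chair 04:39:12Z / 05:07:51Z); REF pre-read-back
ref-3 g3 05:33:19Z (type-exact, witness inside the printed hypotheses).
-/

noncomputable section

-- cell convention (SoloRefute files): the Theorems namespace repeats `NavierStokesRegularity`.
set_option linter.dupNamespace false

open MeasureTheory Finset UnitAddTorus
open Literature.Analysis Literature.Analysis.FluidPDE Literature.Analysis.FunctionSpaces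
open Literature.Analysis.FunctionSpaces.Torus
open Literature.Claims.NS.Siche2026

namespace Summit.NavierStokesRegularity.NavierStokesRegularity.Theorems.Siche2026

/-! ## 5. `N_{4^a} = 6`: the lattice sphere `x² + y² + z² = 4^a` is `{±2^a eᵢ}` -/

/-- If `4 ∣ x² + y² + z²` then `x, y, z` are all even (squares are `0` or `1 mod 4`). [folklore] -/
theorem even_of_four_dvd_sum_sq (x y z : ℤ) (h : (4 : ℤ) ∣ x ^ 2 + y ^ 2 + z ^ 2) :
    Even x ∧ Even y ∧ Even z := by
  have sq_even : ∀ w : ℤ, Even w → (4 : ℤ) ∣ w ^ 2 := by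
    rintro w ⟨m, rfl⟩; exact ⟨m * m, by ring⟩
  have sq_odd : ∀ w : ℤ, Odd w → w ^ 2 % 4 = 1 := by
    rintro w ⟨m, rfl⟩
    have e : (2 * m + 1) ^ 2 = 4 * (m * m + m) + 1 := by ring
    rw [e]; generalize m * m + m = q; omega
  rcases Int.even_or_odd x with hx | hx <;> rcases Int.even_or_odd y with hy | hy <;>
    rcases Int.even_or_odd z with hz | hz
  · exact ⟨hx, hy, hz⟩
  · have := sq_even x hx; have := sq_even y hy; have := sq_odd z hz; omega
  · have := sq_even x hx; have := sq_odd y hy; have := sq_even z hz; omega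
  · have := sq_even x hx; have := sq_odd y hy; have := sq_odd z hz; omega
  · have := sq_odd x hx; have := sq_even y hy; have := sq_even z hz; omega
  · have := sq_odd x hx; have := sq_even y hy; have := sq_odd z hz; omega
  · have := sq_odd x hx; have := sq_odd y hy; have := sq_even z hz; omega
  · have := sq_odd x hx; have := sq_odd y hy; have := sq_odd z hz; omega

/-- The six axis points `±2^a eᵢ` of `ℤ³`, as a set of coordinate triples (a `Set`, deliberately not a
`Prop`-valued predicate). [folklore] -/
def axisPoints (a : ℕ) : Set (ℤ × ℤ × ℤ) :=
  {p | (p.1 = 2 ^ a ∨ p.1 = -2 ^ a) ∧ p.2.1 = 0 ∧ p.2.2 = 0 ∨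
    p.1 = 0 ∧ (p.2.1 = 2 ^ a ∨ p.2.1 = -2 ^ a) ∧ p.2.2 = 0 ∨
      p.1 = 0 ∧ p.2.1 = 0 ∧ (p.2.2 = 2 ^ a ∨ p.2.2 = -2 ^ a)}

/-- Membership in `axisPoints a`, unfolded. [folklore] -/
theorem mem_axisPoints (a : ℕ) (x y z : ℤ) : (x, y, z) ∈ axisPoints a ↔
    ((x = 2 ^ a ∨ x = -2 ^ a) ∧ y = 0 ∧ z = 0 ∨
      x = 0 ∧ (y = 2 ^ a ∨ y = -2 ^ a) ∧ z = 0 ∨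
        x = 0 ∧ y = 0 ∧ (z = 2 ^ a ∨ z = -2 ^ a)) := Iff.rfl

/-- The six axis points lie on the lattice sphere `x² + y² + z² = 4^a`. [folklore] -/
theorem sum_sq_of_onAxes {a : ℕ} {x y z : ℤ} (h : (x, y, z) ∈ axisPoints a) :
    x ^ 2 + y ^ 2 + z ^ 2 = 4 ^ a := by
  have e : (4 : ℤ) ^ a = (2 ^ a) ^ 2 := by
    rw [← pow_mul, mul_comm, pow_mul]; norm_num
  rw [mem_axisPoints] at h
  rcases h with ⟨hx | hx, hy, hz⟩ | ⟨hx, hy | hy, hz⟩ | ⟨hx, hy, hz | hz⟩ <;> subst hx hy hz <;>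
    rw [e] <;> ring

/-- `x² + y² + z² = 1` iff `(x,y,z) = ±eᵢ`. [folklore] -/
theorem onAxes_zero_iff (x y z : ℤ) : x ^ 2 + y ^ 2 + z ^ 2 = 1 ↔ (x, y, z) ∈ axisPoints 0 := by
  constructor
  · intro h
    have hx : -1 ≤ x ∧ x ≤ 1 := by
      constructor <;> nlinarith [sq_nonneg y, sq_nonneg z, sq_nonneg (x + 1), sq_nonneg (x - 1)]
    have hy : -1 ≤ y ∧ y ≤ 1 := by
      constructor <;> nlinarith [sq_nonneg x, sq_nonneg z, sq_nonneg (y + 1), sq_nonneg (y - 1)]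
    have hz : -1 ≤ z ∧ z ≤ 1 := by
      constructor <;> nlinarith [sq_nonneg x, sq_nonneg y, sq_nonneg (z + 1), sq_nonneg (z - 1)]
    obtain ⟨hx1, hx2⟩ := hx
    obtain ⟨hy1, hy2⟩ := hy
    obtain ⟨hz1, hz2⟩ := hz
    rw [mem_axisPoints]
    interval_cases x <;> interval_cases y <;> interval_cases z <;> simp_all
  · intro h
    simpa using sum_sq_of_onAxes h

/-- Doubling: `(2x,2y,2z)` is an axis point of level `a+1` iff `(x,y,z)` is one of level `a`. [folklore] -/
theorem onAxes_succ_iff (a : ℕ) (x y z : ℤ) :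
    (2 * x, 2 * y, 2 * z) ∈ axisPoints (a + 1) ↔ (x, y, z) ∈ axisPoints a := by
  rw [mem_axisPoints, mem_axisPoints]
  have e : (2 : ℤ) ^ (a + 1) = 2 * 2 ^ a := by ring
  rw [e]
  constructor
  · rintro (⟨hx, hy, hz⟩ | ⟨hx, hy, hz⟩ | ⟨hx, hy, hz⟩)
    · left; refine ⟨?_, by linarith, by linarith⟩
      rcases hx with hx | hx
      · left; linarith
      · right; linarith
    · right; left; refine ⟨by linarith, ?_, by linarith⟩
      rcases hy with hy | hy
      · left; linarith
      · right; linarith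
    · right; right; refine ⟨by linarith, by linarith, ?_⟩
      rcases hz with hz | hz
      · left; linarith
      · right; linarith
  · rintro (⟨hx, hy, hz⟩ | ⟨hx, hy, hz⟩ | ⟨hx, hy, hz⟩)
    · left; refine ⟨?_, by linarith, by linarith⟩
      rcases hx with hx | hx
      · left; linarith
      · right; linarith
    · right; left; refine ⟨by linarith, ?_, by linarith⟩
      rcases hy with hy | hy
      · left; linarith
      · right; linarith
    · right; right; refine ⟨by linarith, by linarith, ?_⟩
      rcases hz with hz | hz
      · left; linarith
      · right; linarith

/-- **`r₃(4^a) = 6`, explicitly**: `x² + y² + z² = 4^a` iff `(x,y,z)` is one of the six points `±2^a eᵢ`. [folklore] -/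
theorem sum_sq_eq_four_pow_iff (a : ℕ) (x y z : ℤ) :
    x ^ 2 + y ^ 2 + z ^ 2 = 4 ^ a ↔ (x, y, z) ∈ axisPoints a := by
  induction a generalizing x y z with
  | zero => simpa using onAxes_zero_iff x y z
  | succ a ih =>
    constructor
    · intro h
      have h4 : (4 : ℤ) ∣ x ^ 2 + y ^ 2 + z ^ 2 := ⟨4 ^ a, by rw [h]; ring⟩
      obtain ⟨⟨x', hx⟩, ⟨y', hy⟩, ⟨z', hz⟩⟩ := even_of_four_dvd_sum_sq x y z h4
      have hx2 : x = 2 * x' := by rw [hx]; ring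
      have hy2 : y = 2 * y' := by rw [hy]; ring
      have hz2 : z = 2 * z' := by rw [hz]; ring
      have h' : x' ^ 2 + y' ^ 2 + z' ^ 2 = 4 ^ a := by
        have : 4 * (x' ^ 2 + y' ^ 2 + z' ^ 2) = 4 * 4 ^ a := by
          rw [← pow_succ', ← h, hx2, hy2, hz2]; ring
        linarith
      rw [hx2, hy2, hz2, onAxes_succ_iff]
      exact (ih x' y' z').mp h'
    · exact sum_sq_of_onAxes

/-- The shell `|k|² = 4^a` of `ℤ³`, as an explicit six-element set. [folklore] -/
def axesShell (a : ℕ) : Finset Z3 :=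
  {ax' 0 (2 ^ a), ax' 0 (-(2 ^ a)), ax' 1 (2 ^ a), ax' 1 (-(2 ^ a)), ax' 2 (2 ^ a), ax' 2 (-(2 ^ a))}
where
  /-- `n eᵢ` [folklore] -/
  ax' (i : Fin 3) (n : ℤ) : Z3 := Pi.single i n

/-- `axesShell a` has at most six elements. [folklore] -/
theorem card_axesShell_le (a : ℕ) : (axesShell a).card ≤ 6 := by
  unfold axesShell
  refine (card_insert_le _ _).trans ?_
  refine (Nat.succ_le_succ (card_insert_le _ _)).trans ?_
  refine (Nat.succ_le_succ (Nat.succ_le_succ (card_insert_le _ _))).trans ?_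
  refine (Nat.succ_le_succ (Nat.succ_le_succ (Nat.succ_le_succ (card_insert_le _ _)))).trans ?_
  refine (Nat.succ_le_succ (Nat.succ_le_succ (Nat.succ_le_succ (Nat.succ_le_succ (card_insert_le _ _))))).trans ?_
  simp

/-- **Every lattice point with `Σᵢ kᵢ² = 4^a` lies in the six-element set `axesShell a`** — so any
shell-indexed quantity bounded by the number of lattice points on the shell is `≤ 6` on the shells `4^a`. [folklore] -/
theorem mem_axesShell_of_sum_sq {a : ℕ} {k : Z3} (hk : k 0 ^ 2 + k 1 ^ 2 + k 2 ^ 2 = 4 ^ a) :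
    k ∈ axesShell a := by
  have h := (sum_sq_eq_four_pow_iff a (k 0) (k 1) (k 2)).mp hk
  rw [mem_axisPoints] at h
  unfold axesShell axesShell.ax'
  simp only [mem_insert, mem_singleton]
  rcases h with ⟨hx | hx, hy, hz⟩ | ⟨hx, hy | hy, hz⟩ | ⟨hx, hy, hz | hz⟩
  · left; ext i; fin_cases i <;> simp [hx, hy, hz]
  · right; left; ext i; fin_cases i <;> simp [hx, hy, hz]
  · right; right; left; ext i; fin_cases i <;> simp [hx, hy, hz]
  · right; right; right; left; ext i; fin_cases i <;> simp [hx, hy, hz]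
  · right; right; right; right; left; ext i; fin_cases i <;> simp [hx, hy, hz]
  · right; right; right; right; right; ext i; fin_cases i <;> simp [hx, hy, hz]

/-! ## 6. Evaluation against the typed Step 6 (Prop. 7.2 (59) p. 24) -/

/-- Members of the typed shell `S_K` have lattice norm `K`. [cite: Siche2026, §2.2 (6) p. 4] -/
theorem latticeNormSq_of_mem_shell {K : ℕ} {k : Z3} (hk : k ∈ shell K) : latticeNormSq k = K :=
  (Finset.mem_filter.1 hk).2

/-- `|n e₁|² = n²`. [folklore] -/
theorem latticeNormSq_ax (n : ℤ) : latticeNormSq (ax n) = n ^ 2 := by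
  simp [latticeNormSq, Fin.sum_univ_three]

/-- Lacunary frequencies lie on the shells `|k|² = 4^a`, `1 ≤ a ≤ M`. [folklore] -/
theorem latticeNormSq_of_mem_lacFreq {M : ℕ} {k : Z3} (hk : k ∈ lacFreq M) :
    ∃ a ∈ Icc 1 M, latticeNormSq k = 4 ^ a := by
  rw [mem_lacFreq] at hk
  obtain ⟨a, ha, rfl | rfl⟩ := hk <;> refine ⟨a, ha, ?_⟩ <;> rw [latticeNormSq_ax] <;>
    [skip; rw [neg_sq]] <;> rw [← pow_mul, mul_comm, pow_mul] <;> norm_num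

/-- **`#S ≤ 6` for any set of lattice points of lattice norm `4^a`** (`r₃(4^a) = 6`). [folklore] -/
theorem card_le_six_of_latticeNormSq {a : ℕ} {S : Finset Z3} (hS : ∀ k ∈ S, latticeNormSq k = 4 ^ a) :
    S.card ≤ 6 := by
  refine (card_le_card fun k hk => mem_axesShell_of_sum_sq ?_).trans (card_axesShell_le a)
  have := hS k hk
  simpa [latticeNormSq, Fin.sum_univ_three] using this

/-- **`N_K ≤ 12` on every shell met by the lacunary set.** [folklore] -/
theorem shellModes_le_of_mem {M K : ℕ} {k : Z3} (hk : k ∈ shell K) (hkl : k ∈ lacFreq M) :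
    shellModes K ≤ 12 := by
  obtain ⟨a, -, hka⟩ := latticeNormSq_of_mem_lacFreq hkl
  have hKa : (K : ℤ) = 4 ^ a := by rw [← latticeNormSq_of_mem_shell hk, hka]
  have hcard : (shell K).card ≤ 6 :=
    card_le_six_of_latticeNormSq fun k' hk' => by rw [latticeNormSq_of_mem_shell hk', hKa]
  unfold shellModes
  omega

/-- Off the lacunary set the Fourier coefficients of the weighted shear field vanish. [folklore] -/
theorem coeff_shearW_eq_zero (M : ℕ) (c : ℝ) {r : Z3 → ℝ} (hr : ∀ k, r (-k) = r k) {k : Z3}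
    (hk : k ∉ lacFreq M) : coeff (shearW M c r) k = 0 := by
  unfold coeff shearW
  exact mFourierCoeff_realTrigPoly_eq_zero (neg_mem_lacFreq M) (isConjSymm_coeffW c hr) hk

/-- Off the lacunary set both helical coordinates of the weighted shear field vanish. [folklore] -/
theorem helCoeff_shearW_eq_zero (M : ℕ) (c : ℝ) {r : Z3 → ℝ} (hr : ∀ k, r (-k) = r k) {k : Z3}
    (hk : k ∉ lacFreq M) (σ : Bool) : helCoeff (shearW M c r) k σ = 0 := by
  unfold helCoeff
  rw [coeff_shearW_eq_zero M c hr hk, inner_zero_right]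

/-- On a shell missed by the lacunary set the shifted magnetisation is `0` (silent shell). [folklore] -/
theorem magnetization_shearW_eq_zero (M : ℕ) (c : ℝ) {r : Z3 → ℝ} (hr : ∀ k, r (-k) = r k) {K : ℕ}
    (hK : ∀ k ∈ shell K, k ∉ lacFreq M) (x : T3) : magnetization (shearW M c r) K x = 0 := by
  unfold magnetization
  rw [Finset.sum_eq_zero fun k hk => by
    rw [helCoeff_shearW_eq_zero M c hr (hK k hk), helCoeff_shearW_eq_zero M c hr (hK k hk), add_zero,
      mul_zero], mul_zero]

/-- **Every shifted shell coherence of the weighted shear field is `≤ 12`** — the hypothesis of (59) with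
`C_χ = 12`, uniformly in `M`, the weight, the shell and the shift. [folklore] -/
theorem coherence_shearW_le (M : ℕ) (c : ℝ) {r : Z3 → ℝ} (hr : ∀ k, r (-k) = r k) (K : ℕ) (x : T3) :
    coherence (shearW M c r) K x ≤ 12 := by
  by_cases hK : ∃ k ∈ shell K, k ∈ lacFreq M
  · obtain ⟨k, hk, hkl⟩ := hK
    have h12 : (shellModes K : ℝ) ≤ 12 := by exact_mod_cast shellModes_le_of_mem hk hkl
    exact (coherence_le_shellModes _ K x).trans h12
  · push Not at hK
    unfold coherence
    rw [magnetization_shearW_eq_zero M c hr hK x, norm_zero]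
    norm_num

/-- **The squared vorticity at the origin** of the weighted shear field is `(∂₁u₀(0))²` (all other entries
of `∇u(0)` vanish). [folklore] -/
theorem torusVorticitySqAt_shearW_origin (M : ℕ) (c : ℝ) (r : Z3 → ℝ) :
    torusVorticitySqAt (shearW M c r) 0 = (partialDeriv 1 (shearW M c r) 0 0) ^ 2 := by
  unfold torusVorticitySqAt
  have h0 : ∀ j, partialDeriv 0 (shearW M c r) 0 j = 0 := fun j =>
    partialDeriv_shearW_apply_of_dir M c r (by decide) j 0
  have h2 : ∀ j, partialDeriv 2 (shearW M c r) 0 j = 0 := fun j =>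
    partialDeriv_shearW_apply_of_dir M c r (by decide) j 0
  have h11 : partialDeriv 1 (shearW M c r) 0 1 = 0 := partialDeriv_shearW_apply_of_ne M c r 1 (by decide) 0
  have h12 : partialDeriv 1 (shearW M c r) 0 2 = 0 := partialDeriv_shearW_apply_of_ne M c r 1 (by decide) 0
  simp only [Fin.sum_univ_three, h0, h2, h11, h12]
  ring

/-- **`¬ Step6_vorticityBound`: Proposition 7.2 (59) p. 24, as typed at field grain, is false.** For `ν = 1`
and any candidate `C`, the lacunary shear sum `u_M` with `M > C(1, 12)²` has energy `≤ 1/12 ≤ 1`, all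
coherences `≤ 12`, `‖∇u_M‖² = 2π²M` and `|ω(0)|² = 4π²M² > C(1,12)² · 2π²M`.
[cite: Siche2026, Proposition 7.2 (59) p. 24] -/
theorem not_Step6_vorticityBound : ¬ Step6_vorticityBound := by
  intro h
  obtain ⟨C, hC⟩ := h 1 one_pos
  obtain ⟨M, hM⟩ := exists_nat_gt (C 1 12 ^ 2)
  have hMpos : (0 : ℝ) < M := (sq_nonneg _).trans_lt hM
  have hE : kineticEnergy (shearW M 1 fun _ => 1) ≤ 1 :=
    (kineticEnergy_shearW_le M 1 (fun _ => rfl) fun _ => by norm_num).trans (by norm_num)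
  have key := hC 1 12 (shearW M 1 fun _ => 1) (isSmooth_shearW M 1 _) (isDivFree_shearW M 1 _) hE
    (fun K x => coherence_shearW_le M 1 (fun _ => rfl) K x) 0
  rw [torusVorticitySqAt_shearW_origin, partialDeriv_one_shearW_origin_one, gradNormSq_shearW_one] at key
  have hπ := Real.pi_pos
  have h1 : 2 * Real.pi ^ 2 * (M : ℝ) * C 1 12 ^ 2 < 2 * Real.pi ^ 2 * M * M :=
    mul_lt_mul_of_pos_left hM (by positivity)
  have h2 : 0 < Real.pi ^ 2 * (M : ℝ) * M := by positivity
  nlinarith [key, h1, h2]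

end Summit.NavierStokesRegularity.NavierStokesRegularity.Theorems.Siche2026

end
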